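import Literature.AnabelianGeometry.AbsoluteAnabelian.AbsTopII.EllipticCuspidalizationComparisonPrimeContent
import Literature.AnabelianGeometry.AbsoluteAnabelian.EllipticTorsionCovering
import HarnessLib

/-!
# [AbsTopII] Cor 3.3 (iii)(a) with the ⋏-step PINNED to the `[N]`-covering ("entirely group-theoretic
# description"), canonical outputs, and Cor 3.4 over the datum (`Cor_3_4′`)

S. Mochizuki, *Topics in Absolute Anabelian Geometry II: Decomposition Groups and Endomorphisms*
[AbsTopII] (bib `MochizukiAbsTopII2013`; locators = PDF pages of the kurims manuscript
`paper:url-585b8d0ad0d9`, read on the cell's render p0066–p0070), Example 3.2 (i)(ii) pp. 66–67,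
Corollary 3.3 (iii) pp. 68–69, Corollary 3.4 pp. 69–70.

Statements file (abc-iut cell, row «COR34-DATUM» steps (S2)–(S5), abc-iut-L4-lead RULINGS #8g (1) /
#8i (4), design memo STATUS 11:36:54Z; seat abc-iut-L4-t4 gen 7; (S2) offered to abc-iut-L4-t6 by first
refusal until 11:52Z, unclaimed).  THE PROBLEM (abc-iut-L4-t6 10:57:24Z, confirmed by the memo): Cor 3.4
compares, for `i = 1, 2`, THE scheme-theoretic cuspidalizations `Π_{U_{Xᵢ}} ↠ Πᵢ` (`U_{Xᵢ}` = `Xᵢ`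
minus the images of the `N`-torsion of the elliptic curve of `Dᵢ`); over the datum (no points) the
comparands must be the OUTPUTS of the Cor 3.3 (iii) algorithm, and that is faithful only if the typed
output predicate pins `Π_{U_X} ↠ Π` up to isomorphism over `Π`.  abc-iut-L4-t6's
`EllipticCuspidalization.RealizesChain` (p433376) asks for SOME pro-`Σ` chain of type
`⋏, ⋎, ⋏, •^{N²−1}, ⋏, ⋎` whose •-block computes `K.projU`; its ⋏-step "`D ⇝ U`" (Ex 3.2 (i): the
covering `[N]_D : U = E ∖ E[N] → D`, degree `N²`) is an ARBITRARY open subgroup of `Π_D`, whereas print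
(Cor 3.3 (iii)(a)) has "a `Π`-chain, which admits an entirely 'group-theoretic' description".  THIS FILE:

* (S2) `EllipticCuspidalization.RealizesChainPinned K S CD hP hΔ hne H` — `RealizesChain` VERBATIM
  (same chain data `c, s, t, v, eU, eD, eV, gU, gD, gV, ψ` and clauses) PLUS the pin: the term before
  `Π_s ≅ Π_U` is identified with the third-to-last term `Π_t ≅ Π_D` compatibly with the rigidifying
  homomorphisms (both are "`Π_D`" in Ex 3.2 (ii): `X ⇝ V ⇝ D ⇝ U ⇝ ⋯ ⇝ U₁ = D ⇝ V ⇝ X`), and under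
  this identification and `eD` the ⋏-operation `Π_s ↪ Π_{s−1}` ([AbsTopI] Def 4.2 (iii)(a), injective,
  open, rigidification-compatible) has image CONJUGATE IN `Π_D` to the prescribed subgroup
  `H ∩ Π_D ⊆ Π_C` (open subgroups up to conjugacy = finite étale covers up to isomorphism);
* (S3) `EllipticDatumModel.IsCanonicalOutput h s K` — `K` matches the setting `s` (`Matches`, p434497)
  AND realizes a chain pinned to THE `[N]`-covering subgroup of `D` read in `Π_C`: `H :=` the image under
  the representative `s.coverHom : Π_D → Π_C` of `torsionCoveringSubgroup (cusps of D) x (s.level)`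
  (`EllipticTorsionCovering.lean`, (S1): `(Π_D ↠ Π_E)⁻¹(N·Δ_E · D_O)`), transported to `K.core` by the
  core identification of `Matches`; `x` the cusp of the once-punctured `D` (`∃ x`: all cusps of `D` are
  conjugate in any étale-`π₁` instance);
* (S5) `EllipticDatumModel.Cor_3_3_iii‴` — Cor 3.3 (iii) over the datum WITH the group-theoretic
  description of (a): as `Cor_3_3_iii″` (p434762) with "some CANONICAL output" (`IsCanonicalOutput`);
* (S4) `EllipticDatumModel.Cor_3_4′` — **Corollary 3.4 over the datum**: for members `X₁`, `X₂` with
  datum cores and settings of the same `Σ₁ ∩ Σ₂`-integer `N`, a common `l` with `χ_l` open, CANONICAL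
  outputs `K₁`, `K₂`, and `φ : Π₁ ⥲ Π₂` with `φ(Δ₁) = Δ₂`: "there exists an isomorphism of profinite groups
  `φ_U : Π_{U_{X₁}} ⥲ Π_{U_{X₂}}` that is compatible with `φ`, relative to the natural surjections
  `Π_{U_{Xᵢ}} ↠ Πᵢ`.  Moreover, such an isomorphism is unique up to composition with an inner automorphism
  arising from an element of the kernel of `Π_{U_{Xᵢ}} ↠ Πᵢ`" — verbatim the conclusion of the frozen
  `EllipticModel.Cor_3_4` (p409138; free `cuspUX`, schema-refuted F-0292) with `M.cuspUX sᵢ` replaced by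
  the canonical outputs' `Kᵢ.proj : Kᵢ.cuspUX ↠ Πᵢ`.

**v2 (finding F-L4t6g7-1, abc-iut-L4-t6's typer-of-record read 12:10:20Z of the staged (S2), which had
already landed as p443511): the ω-clause of `RealizesChainPinned` is UNSATISFIABLE AT GENUINE DATA for
`N ≥ 2`.**  The terms `Π_{s−1}` and `Π_t` are both abstractly `Π_D` but carry DIFFERENT rigidifying
homomorphisms from `Π̃` (`ρ_{s−1} = ι ∘ ρ_s` through `[N]_D`, `ρ_t = π ∘ ρ_s` through the open immersion
`U ⊆ D`), so a rigidification-compatible `ω : Π_{s−1} → Π_t` forces `ω ∘ ι = π` on an open subgroup,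
`ω ∘ ι` injective while `Ker π` contains an (infinite, at genuine data) cuspidal group — contradiction;
hence `IsCanonicalOutput` is EMPTY at every étale-`π₁` instance, `Cor_3_3_iii‴` FALSE there and
`Cor_3_4′` VACUOUS (the F-f067-1 disease).  The four decls stay (landed, SUPERSEDED); the REPAIR
(abc-iut-L4-t6's intrinsic form, adopted verbatim) defines the covering subgroup INSIDE the term
`Π_{s−1}` from the chain's own cuspidal data — `ChainGroup.torsionCovering L C N := closure (K_C ⊔
⟨Δ_L^N⟩ ⊔ C_{Π_L}(C))`, `C` a cuspidal decomposition group in `Δ_{s−1}` ([AbsTopI] Def 4.2 (iii) (3_Π)),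
its commensurator the full decomposition group ([AbsTopI] Lem 4.5 (vi) "`I = C_Π(I ∩ Δ)`") — and pins
`range ι = torsionCovering Π_{s−1} C N` with NO identification of `Π_{s−1}` with anything:
`RealizesChainPinned′` (no `H` parameter), `IsCanonicalOutput′ := Matches ∧ RealizesChainPinned′`,
`Cor_3_3_iii⁗`, `Cor_3_4″` (same shapes as iii‴ / 3.4′ over the primed output predicate).

Companion (`EllipticCuspidalizationCanonicalProofs.lean`): `RealizesChainPinned → RealizesChain`,
`IsCanonicalOutput → Matches ∧ RealizesChain`, `Cor_3_3_iii‴ → Cor_3_3_iii″`, and `Cor_3_4′` at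
`X₁ = X₂`, `s₁ = s₂`, `φ = id`: two canonical outputs for the same data are isomorphic over `Π`, uniquely
up to `Ker(Π_{U_X} ↠ Π)`-inner automorphisms (print's "THE natural surjection … may be constructed").
HONEST RESIDUAL: `galOpen` of a setting is not constrained in `Cor_3_4′` (print: `Cᵢ` a `kᵢ`-core,
`G′ = Gᵢ`; the outputs are assumed given, so Cor 3.3 (iii)'s "`G′` sufficiently small" is not a hypothesis
here); the `V`-dependence of `U_X` (p.70 l.17–24: `U_X` descends `U_V = V ×_D U`) is carried because `K`
records `Π_V`; the identifications `eU/eD/eV/ω` are "over `G` up to inner automorphism" resp.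
rigidification-compatible, the cell's convention for chain terms; instance `G′ = G` as in the frozen
file -- TODO(general form): `G′ ⊊ G`.  HONEST FRAMING: predicates on a MODEL INTERFACE the tree does not
instantiate (étale `π₁`, FOUNDATIONS row 12); typed ≠ proved; nothing here bears on [IUTchIII] Cor 3.12.
-/

noncomputable section

open CategoryTheory Topology
open scoped Pointwise

universe u

namespace Literature.AnabelianGeometry.AbsoluteAnabelian.AbsTopII

open Literature.AlgebraicGeometry.Frobenioids (IsSlimGroup)
open Literature.AnabelianGeometry.Anabelioids (IsSigmaInteger)
open FundamentalExtension
open AbsTopI (ConstructionDataClass)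

/-! ### (S2) Realized chains with the ⋏-step pinned -/

namespace EllipticCuspidalization

variable {E : FundamentalExtension.{u}} (K : EllipticCuspidalization E) (S : Set ℕ)
  (CD : CuspidalData E) (hP : IsSlimGroup E.arith) (hΔ : IsSlimGroup E.geom) (hne : E.geom ≠ ⊥)

/-- **Cor 3.3 (iii)(a) WITH the "entirely group-theoretic description" of the chain** (p. 68 l. 36–45;
Ex 3.2 (i)(ii) pp. 66–67): abc-iut-L4-t6's `RealizesChain` VERBATIM — a pro-`Σ` `Π`-chain `c` of the
output's type-chain `⋏, ⋎, ⋏, •^{N²−1}, ⋏, ⋎` with a terminal isomorphism to the trivial chain, indices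
`s ≤ t < v` with `Π_s ≅ Π_U`, `Π_t ≅ Π_D` (third to last), `Π_v ≅ Π_V` over `G` up to inner automorphisms,
the •-block `Π_s ↠ ⋯ ↠ Π_t` computing `K.projU` — PLUS THE PIN of the ⋏-step "`D ⇝ U`": the term
`Π_{s−1}` is identified with `Π_t` by a rigidification-compatible isomorphism `ω` (both are `Π_D` as a
sub-quotient of `Π̃`), and the ⋏-operation `Π_s ↪ Π_{s−1}` ([AbsTopI] Def 4.2 (iii)(a): injective, open,
rigidification-compatible) has image which, carried by `ω` to `Π_t` and compared through `eD`, is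
CONJUGATE in `Π_t` to the prescribed subgroup `H ∩ Π_D` of `Π_C` — `H` := the `[N]_D`-covering subgroup
"`U = E ∖ E[N] → D`" in the intended use (`EllipticDatumModel.IsCanonicalOutput`).  Relative to cuspidal
data `CD` on `Π` and the slimness inputs of `PiChain`.  **SUPERSEDED (v2, finding F-L4t6g7-1): the
rigidification-compatible `ω : Π_{s−1} → Π_t` is unsatisfiable at genuine data (`Π_{s−1}`, `Π_t` are
different sub-quotients of `Π̃`); use `RealizesChainPinned′` (intrinsic pin, no `H`).**
[cite: MochizukiAbsTopII2013, Cor 3.3 (iii)(a) p.68] -/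
def RealizesChainPinned (H : Subgroup K.core.arith) : Prop :=
  ∃ c : E.PiChain CD hP hΔ hne,
    IsProSigmaChain S c ∧
    c.typeChain = K.typeChain.map ElementaryOp.toElemOpType ∧
    c.HasTerminalIso (trivialChain CD hP hΔ hne) ∧
    ∃ (s t v : Fin (c.len + 1)) (_ : s.val + (K.N ^ 2 - 1) = t.val) (_ : t.val + 1 = v.val)
      (_ : v.val + 1 = c.len)
      (eU : K.cuspU.arith ≃ₜ* (c.term s).grp) (eD : ↥K.PiD ≃ₜ* (c.term t).grp)
      (eV : ↥K.PiV ≃ₜ* (c.term v).grp) (gU gD : K.core.gal) (gV : E.gal)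
      (ψ : ∀ i : Fin (c.len + 1), K.cuspU.arith →* (c.term i).grp),
      (∀ x, K.toCore.gal ((c.term s).proj (eU x)) =
          MulAut.conj gU (K.projU.gal (K.cuspU.aug x))) ∧
      (∀ y : K.PiD, K.toCore.gal ((c.term t).proj (eD y)) = MulAut.conj gD (K.core.aug y)) ∧
      (∀ y : K.PiV, (c.term v).proj (eV y) = MulAut.conj gV (E.aug y)) ∧
      (∀ x, ψ s x = eU x) ∧
      (∀ j : Fin c.len, s.val ≤ j.val → j.val < t.val →
        ∃ φ : (c.term j.castSucc).grp →ₜ* (c.term j.succ).grp,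
          ChainGroup.IsDeCuspVia CD (c.term j.castSucc) (c.term j.succ) φ ∧
            ∀ x, ψ j.succ x = φ (ψ j.castSucc x)) ∧
      (∀ x, ((eD.symm (ψ t x) : ↥K.PiD) : K.core.arith) = K.projU.arith x) ∧
      -- THE PIN (S2): the ⋏-step `Π_s ↪ Π_{s−1} = Π_D` is the prescribed covering `H`, up to conjugacy
      ∃ (r : Fin (c.len + 1)) (_ : r.val + 1 = s.val)
        (ω : (c.term r).grp →ₜ* (c.term t).grp) (ι : (c.term s).grp →ₜ* (c.term r).grp)
        (γ : (c.term t).grp),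
        Function.Bijective ω ∧ ChainGroup.RigCompat (c.term r) (c.term t) ω ∧
        Function.Injective ι ∧ IsOpen (Set.range ι) ∧ ChainGroup.RigCompat (c.term s) (c.term r) ι ∧
        MulAut.conj γ • (ι.toMonoidHom.range.map ω.toMonoidHom) =
          (H.subgroupOf K.PiD).map eD.toMonoidHom

end EllipticCuspidalization

/-! ### (S3) Canonical outputs of the Cor 3.3 (iii) algorithm over the datum -/

namespace EllipticDatumModel

variable {𝒟 : ConstructionDataClass.{u}} (M : EllipticDatumModel 𝒟)

/-- **A CANONICAL output of the Cor 3.3 (iii) algorithm** for the member `X` (standing hypotheses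
`h`), the datum core `f : X → C` and the setting `s`: an `EllipticCuspidalization` `K` of `Π ↠ G` that
MATCHES `s` (`Matches`: same `N`, `Σ`; core `Π_C`; `Π_D`; `Π_V`; output `=` `[π₁]` of a datum open
immersion with the cusps clause (c)) AND realizes a chain whose ⋏-step "`D ⇝ U`" is THE `[N]_D`-covering
(Ex 3.2 (i), "entirely group-theoretic description", Cor 3.3 (iii)(a)): `RealizesChainPinned` with
`H :=` the image in `Π_C`, under the representative `s.coverHom : Π_D → Π_C` of `[π₁(D → C)]`, of
`torsionCoveringSubgroup (M.cusps b s.D) x s.level = (Π_D ↠ Π_E)⁻¹(N·Δ_E · D_O)` for a cusp `x` of the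
once-punctured elliptic curve `D`, transported to `K.core` along a core identification as in `Matches`.
**SUPERSEDED (v2, finding F-L4t6g7-1): EMPTY at genuine data through `RealizesChainPinned`; use
`IsCanonicalOutput′`.** [cite: MochizukiAbsTopII2013, Cor 3.3 (iii) pp.68-69] -/
def IsCanonicalOutput {b : 𝒟.Base} {X : (𝒟.datum b).Obj} (h : M.IsCor33Member b X)
    {C : (𝒟.datum b).Obj} {f : (𝒟.datum b).Hom X C} (s : M.Setting b X C f)
    (K : EllipticCuspidalization ((𝒟.datum b).ext X)) : Prop :=
  M.Matches s K ∧
    ∃ (e : K.core ≅ (𝒟.datum b).ext C) (x : (M.cusps b s.D).Cusp),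
      K.toCore ≫ e.hom = s.toCore.toExtensionHom ∧ K.PiD.map e.hom.arith.toMonoidHom = s.PiD ∧
      K.RealizesChainPinned (𝒟.datum b).primes (M.cusps b X)
        (((𝒟.datum b).ext X).arith_slim_of_geom_slim_of_gal_slim h.geom_slim h.slim)
        h.geom_slim h.geom_ne_bot
        ((((M.cusps b s.D).torsionCoveringSubgroup x s.level).map
            s.coverHom.toHom.toMonoidHom).comap e.hom.arith.toMonoidHom)

/-! ### (S5) Corollary 3.3 (iii‴): a canonical output exists -/

/-- **Corollary 3.3 (iii‴)** pp. 68–69 relative to the datum, WITH (a)'s "entirely 'group-theoretic'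
description" of the chain: as `Cor_3_3_iii″` (for every datum core `f : X → C`, every `N`, some open
`G₀ ⊆ G`, every setting `s` with this `N` and `G′ ⊆ G₀`) there is a CANONICAL output
(`IsCanonicalOutput`: matches `s` and realizes a chain whose ⋏-step is the `[N]_D`-covering) — "for any
`G′ ⊆ G` that is sufficiently small, where 'sufficiently' depends only on `N`, the natural surjection
`Π_{U_X} ↠ Π` — i.e., 'cuspidalization' of `Π` — may be constructed via 'group-theoretic' operations".
**SUPERSEDED (v2, finding F-L4t6g7-1): FALSE at genuine data through `IsCanonicalOutput`; use
`Cor_3_3_iii⁗`.** [cite: MochizukiAbsTopII2013, Cor 3.3 (iii) pp.68-69] -/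
def Cor_3_3_iii''' : Prop :=
  𝒟.IsChainFull → 𝒟.RelIsomDGC →
    ∀ (b : 𝒟.Base) (X : (𝒟.datum b).Obj) (h : M.IsCor33Member b X) (C : (𝒟.datum b).Obj)
      (f : (𝒟.datum b).Hom X C), M.IsFinEt f → M.IsCoreOf b C X → ∀ N : ℕ,
      ∃ G₀ : Subgroup ((𝒟.datum b).ext X).gal, IsOpen (G₀ : Set ((𝒟.datum b).ext X).gal) ∧
        ∀ s : M.Setting b X C f, s.level = N → s.galOpen ≤ G₀ →
          ∃ K : EllipticCuspidalization ((𝒟.datum b).ext X), M.IsCanonicalOutput h s K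

/-! ### (S4) Corollary 3.4 over the datum -/

/-- **Corollary 3.4 (Pro-`Σ` Elliptic Cuspidalization II: Comparison)** pp. 69–70 over the datum:
"Let `𝒟` be a chain-full set of collections of partial construction data such that the rel-isom-DGC
holds.  For `i = 1, 2`, let `Gᵢ` be a slim profinite group; `1 → Δᵢ → Πᵢ → Gᵢ → 1` [a member `Xᵢ`
satisfying the standing hypotheses]; `Cᵢ` a `kᵢ`-core of `Xᵢ`; `Dᵢ → Cᵢ` a finite étale double covering
that exhibits `Cᵢ` as semi-elliptic; [...] `N` a positive integer which is a product of primes [perhaps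
with multipliticites] `∈ Σ₁ ∩ Σ₂`; [`Uᵢ`, `Vᵢ`, `U_{Xᵢ}`;] `Π_{U_{Xᵢ}} ↠ Πᵢ` the natural surjection.
Suppose further that, for some `l ∈ Σ₁ ∩ Σ₂`, the cyclotomic characters `Gᵢ → ℤ_l^×` have open image
for `i = 1, 2`.  Let `φ : Π₁ ⥲ Π₂` be an isomorphism of profinite groups such that `φ(Δ₁) = Δ₂`.  Then
there exists an isomorphism of profinite groups `φ_U : Π_{U_{X₁}} ⥲ Π_{U_{X₂}}` that is compatible with
`φ`, relative to the natural surjections `Π_{U_{Xᵢ}} ↠ Πᵢ`.  Moreover, such an isomorphism is unique up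
to composition with an inner automorphism arising from an element of the kernel of `Π_{U_{Xᵢ}} ↠ Πᵢ`."
TYPED with the cuspidalizations `Π_{U_{Xᵢ}} ↠ Πᵢ` := the CANONICAL OUTPUTS `Kᵢ.proj : Kᵢ.cuspUX ↠ Πᵢ`
of the Cor 3.3 (iii) algorithm for datum cores `fᵢ : Xᵢ → Cᵢ` and settings `sᵢ` of the same level `N`
(`IsCanonicalOutput`; the proof in print: "The construction of `φ_U` follows immediately from Corollary
3.3").  `sᵢ.galOpen` unconstrained (print: `G′ = Gᵢ`; the outputs are given). -- TODO(general form):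
`G′ ⊊ G`.  **SUPERSEDED (v2, finding F-L4t6g7-1): VACUOUS at genuine data through `IsCanonicalOutput`;
use `Cor_3_4″`.** [cite: MochizukiAbsTopII2013, Cor 3.4 pp.69-70] -/
def Cor_3_4' : Prop :=
  𝒟.IsChainFull → 𝒟.RelIsomDGC →
    ∀ (b₁ b₂ : 𝒟.Base) (X₁ : (𝒟.datum b₁).Obj) (X₂ : (𝒟.datum b₂).Obj)
      (h₁ : M.IsCor33Member b₁ X₁) (h₂ : M.IsCor33Member b₂ X₂)
      (C₁ : (𝒟.datum b₁).Obj) (C₂ : (𝒟.datum b₂).Obj)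
      (f₁ : (𝒟.datum b₁).Hom X₁ C₁) (f₂ : (𝒟.datum b₂).Hom X₂ C₂),
      M.IsFinEt f₁ → M.IsCoreOf b₁ C₁ X₁ → M.IsFinEt f₂ → M.IsCoreOf b₂ C₂ X₂ →
      ∀ (s₁ : M.Setting b₁ X₁ C₁ f₁) (s₂ : M.Setting b₂ X₂ C₂ f₂), s₁.level = s₂.level →
        IsSigmaInteger ((𝒟.datum b₁).primes ∩ (𝒟.datum b₂).primes) s₁.level →
        (∃ (l : ℕ) (_ : Fact l.Prime), l ∈ (𝒟.datum b₁).primes ∧ l ∈ (𝒟.datum b₂).primes ∧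
          IsOpen (Set.range (AbsTopIII.cyclotomicChar (𝒟.fld b₁) l)) ∧
          IsOpen (Set.range (AbsTopIII.cyclotomicChar (𝒟.fld b₂) l))) →
        ∀ (K₁ : EllipticCuspidalization ((𝒟.datum b₁).ext X₁))
          (K₂ : EllipticCuspidalization ((𝒟.datum b₂).ext X₂)),
          M.IsCanonicalOutput h₁ s₁ K₁ → M.IsCanonicalOutput h₂ s₂ K₂ →
          ∀ φ : ((𝒟.datum b₁).ext X₁).arith ≃ₜ* ((𝒟.datum b₂).ext X₂).arith,
            ((𝒟.datum b₁).ext X₁).geom.map φ.toMonoidHom = ((𝒟.datum b₂).ext X₂).geom →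
            (∃ φU : K₁.cuspUX.arith ≃ₜ* K₂.cuspUX.arith,
                ∀ x, K₂.proj.arith (φU x) = φ (K₁.proj.arith x)) ∧
            ∀ φU φU' : K₁.cuspUX.arith ≃ₜ* K₂.cuspUX.arith,
              (∀ x, K₂.proj.arith (φU x) = φ (K₁.proj.arith x)) →
              (∀ x, K₂.proj.arith (φU' x) = φ (K₁.proj.arith x)) →
                ∃ g : K₂.cuspUX.arith, K₂.proj.arith g = 1 ∧ ∀ x, φU' x = g * φU x * g⁻¹

end EllipticDatumModel

/-! ## v2 (finding F-L4t6g7-1): the INTRINSIC pin — the covering subgroup defined inside `Π_{s−1}` -/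

/-- **The `[N]`-covering subgroup INSIDE a chain term** `Πⱼ` (abc-iut-L4-t6's intrinsic form of (S1)'s
`CuspidalData.torsionCoveringSubgroup`, read in `Πⱼ` from the chain's own cuspidal data): for a
cuspidal decomposition group `C` in `Δⱼ` ([AbsTopI] Def 4.2 (iii) (3_Π): the geometric part, an
inertia-type group) the closed subgroup generated by `K_C` (the closed normal closure of `C` = the
de-cuspidalization kernel at that cusp), the `N`-th powers of `Δⱼ = Ker(Πⱼ → G)`, and the commensurator
`C_{Πⱼ}(C)` = the FULL decomposition group of the cusp ([AbsTopI] Lem 4.5 (vi) "`I = C_Π(I ∩ Δ)`"): at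
`Πⱼ = Π_D` this is `(Π_D ↠ Π_E)⁻¹(N·Δ_E · D_O)`, the open subgroup of `[N]_D : U = E ∖ E[N] → D`
(Ex 3.2 (i)).  Dot-notation extension of `FundamentalExtension.ChainGroup` (parent directory), declared
with its absolute name. [cite: MochizukiAbsTopII2013, Ex 3.2 (i) p.66] -/
def _root_.Literature.AnabelianGeometry.AbsoluteAnabelian.FundamentalExtension.ChainGroup.torsionCovering
    {E : FundamentalExtension.{u}} (L : E.ChainGroup) (C : Subgroup L.grp) (N : ℕ) : Subgroup L.grp :=
  ((Subgroup.normalClosure (C : Set L.grp)).topologicalClosure ⊔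
      Subgroup.closure ((fun δ : L.grp => δ ^ N) '' (L.geomJ : Set L.grp)) ⊔
      Subgroup.Commensurable.commensurator C).topologicalClosure

namespace EllipticCuspidalization

variable {E : FundamentalExtension.{u}} (K : EllipticCuspidalization E) (S : Set ℕ)
  (CD : CuspidalData E) (hP : IsSlimGroup E.arith) (hΔ : IsSlimGroup E.geom) (hne : E.geom ≠ ⊥)

/-- **Cor 3.3 (iii)(a) WITH the "entirely group-theoretic description" of the chain, v2 (INTRINSIC PIN)**
(p. 68 l. 36–45; Ex 3.2 (i)(ii) pp. 66–67): abc-iut-L4-t6's `RealizesChain` VERBATIM (chain `c`, indices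
`s ≤ t < v`, identifications `eU, eD, eV` over `G` up to inner automorphisms, the •-block computing
`K.projU`) PLUS: the ⋏-operation `ι : Π_s ↪ Π_{s−1}` ([AbsTopI] Def 4.2 (iii)(a): injective, open,
rigidification-compatible) has range EQUAL to the `[N]`-covering subgroup `torsionCovering Π_{s−1} C N`
for some cuspidal decomposition group `C` in `Δ_{s−1}` ((3_Π), relative to the cusps `CD` of `X`) — "the
⋏-step `D ⇝ U` IS `[N]_D : U = E ∖ E[N] → D`", stated inside `Π_{s−1}` with NO identification of
`Π_{s−1}` with another term (repair of F-L4t6g7-1; abc-iut-L4-t6's clause adopted verbatim).  The range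
is `H_N` up to the choice of `C` among its `Π_{s−1}`-conjugates (`torsionCovering (gCg⁻¹) = g H_N g⁻¹`:
`[N]_D` up to deck transformations) — no canonical conjugate is singled out.
[cite: MochizukiAbsTopII2013, Cor 3.3 (iii)(a) p.68] -/
def RealizesChainPinned' : Prop :=
  ∃ c : E.PiChain CD hP hΔ hne,
    IsProSigmaChain S c ∧
    c.typeChain = K.typeChain.map ElementaryOp.toElemOpType ∧
    c.HasTerminalIso (trivialChain CD hP hΔ hne) ∧
    ∃ (s t v : Fin (c.len + 1)) (_ : s.val + (K.N ^ 2 - 1) = t.val) (_ : t.val + 1 = v.val)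
      (_ : v.val + 1 = c.len)
      (eU : K.cuspU.arith ≃ₜ* (c.term s).grp) (eD : ↥K.PiD ≃ₜ* (c.term t).grp)
      (eV : ↥K.PiV ≃ₜ* (c.term v).grp) (gU gD : K.core.gal) (gV : E.gal)
      (ψ : ∀ i : Fin (c.len + 1), K.cuspU.arith →* (c.term i).grp),
      (∀ x, K.toCore.gal ((c.term s).proj (eU x)) =
          MulAut.conj gU (K.projU.gal (K.cuspU.aug x))) ∧
      (∀ y : K.PiD, K.toCore.gal ((c.term t).proj (eD y)) = MulAut.conj gD (K.core.aug y)) ∧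
      (∀ y : K.PiV, (c.term v).proj (eV y) = MulAut.conj gV (E.aug y)) ∧
      (∀ x, ψ s x = eU x) ∧
      (∀ j : Fin c.len, s.val ≤ j.val → j.val < t.val →
        ∃ φ : (c.term j.castSucc).grp →ₜ* (c.term j.succ).grp,
          ChainGroup.IsDeCuspVia CD (c.term j.castSucc) (c.term j.succ) φ ∧
            ∀ x, ψ j.succ x = φ (ψ j.castSucc x)) ∧
      (∀ x, ((eD.symm (ψ t x) : ↥K.PiD) : K.core.arith) = K.projU.arith x) ∧
      -- THE INTRINSIC PIN (v2): the ⋏-step `ι : Π_s ↪ Π_{s−1}` is the `[N]`-covering of `Π_{s−1}`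
      ∃ (r : Fin (c.len + 1)) (_ : r.val + 1 = s.val) (ι : (c.term s).grp →ₜ* (c.term r).grp)
        (C : Subgroup (c.term r).grp),
        Function.Injective ι ∧ IsOpen (Set.range ι) ∧ ChainGroup.RigCompat (c.term s) (c.term r) ι ∧
        C ∈ (c.term r).cuspidalDecompGroups CD ∧
        ι.toMonoidHom.range = (c.term r).torsionCovering C K.N

end EllipticCuspidalization

namespace EllipticDatumModel

variable {𝒟 : ConstructionDataClass.{u}} (M : EllipticDatumModel 𝒟)

/-- **A CANONICAL output of the Cor 3.3 (iii) algorithm, v2** (intrinsic pin; repair of F-L4t6g7-1):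
`K` matches the setting `s` (`Matches`) AND realizes a chain whose ⋏-step "`D ⇝ U`" is the `[N]`-covering
of its own `Π_D`-term (`RealizesChainPinned′`).  No core identification or cusp of `D` is needed: the pin
is read inside the chain. [cite: MochizukiAbsTopII2013, Cor 3.3 (iii) pp.68-69] -/
def IsCanonicalOutput' {b : 𝒟.Base} {X : (𝒟.datum b).Obj} (h : M.IsCor33Member b X)
    {C : (𝒟.datum b).Obj} {f : (𝒟.datum b).Hom X C} (s : M.Setting b X C f)
    (K : EllipticCuspidalization ((𝒟.datum b).ext X)) : Prop :=
  M.Matches s K ∧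
    K.RealizesChainPinned' (𝒟.datum b).primes (M.cusps b X)
      (((𝒟.datum b).ext X).arith_slim_of_geom_slim_of_gal_slim h.geom_slim h.slim)
      h.geom_slim h.geom_ne_bot

/-- **Corollary 3.3 (iii⁗)** pp. 68–69 relative to the datum, v2 of iii‴ (intrinsic pin): for every datum
core `f : X → C`, every `N`, some open `G₀ ⊆ G`, every setting `s` with this `N` and `G′ ⊆ G₀`, there is
a CANONICAL output (`IsCanonicalOutput′`) — Cor 3.3 (iii) with (a)'s "entirely 'group-theoretic'
description" of the chain. [cite: MochizukiAbsTopII2013, Cor 3.3 (iii) pp.68-69] -/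
def Cor_3_3_iii'''' : Prop :=
  𝒟.IsChainFull → 𝒟.RelIsomDGC →
    ∀ (b : 𝒟.Base) (X : (𝒟.datum b).Obj) (h : M.IsCor33Member b X) (C : (𝒟.datum b).Obj)
      (f : (𝒟.datum b).Hom X C), M.IsFinEt f → M.IsCoreOf b C X → ∀ N : ℕ,
      ∃ G₀ : Subgroup ((𝒟.datum b).ext X).gal, IsOpen (G₀ : Set ((𝒟.datum b).ext X).gal) ∧
        ∀ s : M.Setting b X C f, s.level = N → s.galOpen ≤ G₀ →
          ∃ K : EllipticCuspidalization ((𝒟.datum b).ext X), M.IsCanonicalOutput' h s K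

/-- **Corollary 3.4 (Pro-`Σ` Elliptic Cuspidalization II: Comparison) over the datum, v2** (`Cor_3_4″`;
intrinsic pin, repair of F-L4t6g7-1) — verbatim the hypotheses and conclusion of `Cor_3_4′` with the
canonical outputs read by `IsCanonicalOutput′`: for members `X₁`, `X₂` with datum cores and settings of
the same `Σ₁ ∩ Σ₂`-integer `N`, a common `l` with `χ_l` open, canonical outputs `K₁`, `K₂`, and
`φ : Π₁ ⥲ Π₂` with `φ(Δ₁) = Δ₂`: "there exists an isomorphism of profinite groups
`φ_U : Π_{U_{X₁}} ⥲ Π_{U_{X₂}}` that is compatible with `φ`, relative to the natural surjections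
`Π_{U_{Xᵢ}} ↠ Πᵢ`.  Moreover, such an isomorphism is unique up to composition with an inner automorphism
arising from an element of the kernel of `Π_{U_{Xᵢ}} ↠ Πᵢ`." -- TODO(general form): `G′ ⊊ G`.
[cite: MochizukiAbsTopII2013, Cor 3.4 pp.69-70] -/
def Cor_3_4'' : Prop :=
  𝒟.IsChainFull → 𝒟.RelIsomDGC →
    ∀ (b₁ b₂ : 𝒟.Base) (X₁ : (𝒟.datum b₁).Obj) (X₂ : (𝒟.datum b₂).Obj)
      (h₁ : M.IsCor33Member b₁ X₁) (h₂ : M.IsCor33Member b₂ X₂)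
      (C₁ : (𝒟.datum b₁).Obj) (C₂ : (𝒟.datum b₂).Obj)
      (f₁ : (𝒟.datum b₁).Hom X₁ C₁) (f₂ : (𝒟.datum b₂).Hom X₂ C₂),
      M.IsFinEt f₁ → M.IsCoreOf b₁ C₁ X₁ → M.IsFinEt f₂ → M.IsCoreOf b₂ C₂ X₂ →
      ∀ (s₁ : M.Setting b₁ X₁ C₁ f₁) (s₂ : M.Setting b₂ X₂ C₂ f₂), s₁.level = s₂.level →
        IsSigmaInteger ((𝒟.datum b₁).primes ∩ (𝒟.datum b₂).primes) s₁.level →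
        (∃ (l : ℕ) (_ : Fact l.Prime), l ∈ (𝒟.datum b₁).primes ∧ l ∈ (𝒟.datum b₂).primes ∧
          IsOpen (Set.range (AbsTopIII.cyclotomicChar (𝒟.fld b₁) l)) ∧
          IsOpen (Set.range (AbsTopIII.cyclotomicChar (𝒟.fld b₂) l))) →
        ∀ (K₁ : EllipticCuspidalization ((𝒟.datum b₁).ext X₁))
          (K₂ : EllipticCuspidalization ((𝒟.datum b₂).ext X₂)),
          M.IsCanonicalOutput' h₁ s₁ K₁ → M.IsCanonicalOutput' h₂ s₂ K₂ →
          ∀ φ : ((𝒟.datum b₁).ext X₁).arith ≃ₜ* ((𝒟.datum b₂).ext X₂).arith,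
            ((𝒟.datum b₁).ext X₁).geom.map φ.toMonoidHom = ((𝒟.datum b₂).ext X₂).geom →
            (∃ φU : K₁.cuspUX.arith ≃ₜ* K₂.cuspUX.arith,
                ∀ x, K₂.proj.arith (φU x) = φ (K₁.proj.arith x)) ∧
            ∀ φU φU' : K₁.cuspUX.arith ≃ₜ* K₂.cuspUX.arith,
              (∀ x, K₂.proj.arith (φU x) = φ (K₁.proj.arith x)) →
              (∀ x, K₂.proj.arith (φU' x) = φ (K₁.proj.arith x)) →
                ∃ g : K₂.cuspUX.arith, K₂.proj.arith g = 1 ∧ ∀ x, φU' x = g * φU x * g⁻¹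

end EllipticDatumModel

end Literature.AnabelianGeometry.AbsoluteAnabelian.AbsTopII

end
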